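import Literature.Computability.Complexity.SymmetricThresholdProgramsCounting
import Literature.Combinatorics.SimpleGraph.SwitchingEquivalentGraph
import HarnessLib

/-!
# Symmetric threshold programs: the switching-equivalent graph of a wire-given coloured part

A reusable GADGET for symmetric threshold programs (`SymProg`): the adjacency of the
SWITCHING-EQUIVALENT GRAPH `G_P` (Laubner 2011, Def. 3.3.2: complement every block of density
`> 1/2`) of the current colouring of the current part — the section step of Corneil–Goldberg
canonisation as the window canoniser of route `PneNP/SymmetryBudget` (item `NoHiddenOrder`) needs
it, relative to a DATA-DEPENDENT part.  Inputs (wires): membership `mem`, adjacency `adj`, and the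
kernel `eq u v = [col u = col v]` of the current colouring.  Per pair `(u, v)`: the pair gates
`pr u v a b = [a ∈ cell u, b ∈ cell v]`, `apr u v a b = pr u v a b ∧ adj a b`, the "less than
twice" test `tw u v = [#pr < 2·#apr]` (`CmpTwice`, `SymmetricThresholdProgramsCounting.lean`), and
`sw u v = [u ≠ v] ∧ mem u ∧ mem v ∧ (adj u v XOR tw u v)`.

* `Switching.sem_tw_iff` — for members, `tw a b` carries `Switch G_U col (col a) (col b)` of
  `Literature/Combinatorics/SimpleGraph/SwitchingEquivalentGraph.lean` on the induced graph of the part;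
* `Switching.sem_sw_iff` — `sw a b` carries `(swGraph G_U col).Adj a b`; off the part `sw` is off
  (`sem_sw_of_not_mem`), so `sw` feeds the reachability gadget (`SymmetricThresholdProgramsReach.lean`)
  to produce the sections (connected components of `G_P`).
Gate count `O(|V|⁴ + |V|²·N)`.

## References
* B. Laubner, *The structure of graphs and new logics for the characterization of Polynomial
  Time*, PhD thesis, HU Berlin 2011, Def. 3.3.2 [Laubner2011].
* D. G. Corneil, M. Goldberg, *A non-factorial algorithm for canonical numbering of a graph*,
  J. Algorithms 5 (1984) [CorneilGoldberg1984].
* M. Anderson, A. Dawar, *On symmetric circuits and fixed-point logics*, Theory Comput. Syst. 60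
  (2017), §3 [AndersonDawar2016].
-/

namespace Literature.Computability.Complexity

open Finset Literature.Combinatorics.SimpleGraph

namespace SymProg

variable {ι Λ : Type*} [DecidableEq ι] [DecidableEq Λ] (P : SymProg ι Λ)
variable (V : Type*) [Fintype V] [DecidableEq V] (N : ℕ)

/-- **The switching gadget** inside `P` over the vertex type `V` with count bound `N` (`N ≥ |part|²`).
[cite: Laubner2011, Def. 3.3.2] -/
structure Switching where
  /-- membership wire of the current part -/
  mem : V → ι ⊕ Λ
  /-- adjacency wire -/
  adj : V → V → ι ⊕ Λ
  /-- kernel wire of the current colouring: `[col u = col v]` -/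
  eq : V → V → ι ⊕ Λ
  /-- `pr u v a b`: `a, b` are members, `a` has the colour of `u`, `b` the colour of `v` -/
  pr : V → V → V → V → Λ
  /-- `apr u v a b = pr u v a b ∧ adj a b` -/
  apr : V → V → V → V → Λ
  /-- the test `#pr < 2·#apr` for the block `(cell u, cell v)` -/
  twice : V → V → P.CmpTwice N
  /-- `nadj u v = ¬ adj u v` -/
  nadj : V → V → Λ
  /-- `ntw u v = ¬ tw u v` -/
  ntw : V → V → Λ
  /-- `kept u v = adj u v ∧ ¬ tw u v` (an edge of an unswitched block) -/
  kept : V → V → Λ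
  /-- `added u v = ¬ adj u v ∧ tw u v` (a non-edge of a switched block) -/
  added : V → V → Λ
  /-- `sw' u v = kept u v ∨ added u v` (the XOR of `adj` and `tw`) -/
  sw' : V → V → Λ
  /-- OUTPUT `sw u v`: adjacency in the switching-equivalent graph of the part -/
  sw : V → V → Λ
  pr_injective : ∀ u v, Function.Injective fun ab : V × V => pr u v ab.1 ab.2
  apr_injective : ∀ u v, Function.Injective fun ab : V × V => apr u v ab.1 ab.2
  kind_pr : ∀ u v a b, P.kind (pr u v a b) = Kind.and
  srcs_pr : ∀ u v a b, P.srcs (pr u v a b) = {mem a, mem b, eq a u, eq b v}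
  kind_apr : ∀ u v a b, P.kind (apr u v a b) = Kind.and
  srcs_apr : ∀ u v a b, P.srcs (apr u v a b) = {Sum.inr (pr u v a b), adj a b}
  twice_A : ∀ u v, (twice u v).A = univ.image fun ab : V × V => Sum.inr (pr u v ab.1 ab.2)
  twice_B : ∀ u v, (twice u v).B = univ.image fun ab : V × V => Sum.inr (apr u v ab.1 ab.2)
  kind_nadj : ∀ u v, P.kind (nadj u v) = Kind.nor
  srcs_nadj : ∀ u v, P.srcs (nadj u v) = {adj u v}
  kind_ntw : ∀ u v, P.kind (ntw u v) = Kind.nor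
  srcs_ntw : ∀ u v, P.srcs (ntw u v) = {Sum.inr (twice u v).tw}
  kind_kept : ∀ u v, P.kind (kept u v) = Kind.and
  srcs_kept : ∀ u v, P.srcs (kept u v) = {adj u v, Sum.inr (ntw u v)}
  kind_added : ∀ u v, P.kind (added u v) = Kind.and
  srcs_added : ∀ u v, P.srcs (added u v) = {Sum.inr (nadj u v), Sum.inr (twice u v).tw}
  kind_sw' : ∀ u v, P.kind (sw' u v) = Kind.or
  srcs_sw' : ∀ u v, P.srcs (sw' u v) = {Sum.inr (kept u v), Sum.inr (added u v)}
  kind_sw : ∀ u v, P.kind (sw u v) = if u = v then Kind.or else Kind.and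
  srcs_sw : ∀ u v, P.srcs (sw u v) = if u = v then ∅ else {mem u, mem v, Sum.inr (sw' u v)}

namespace Switching

variable {P V N} (S : P.Switching V N) (x : ι → Bool)

/-- The membership predicate on input `x`. [folklore] -/
def Mem (u : V) : Prop := wval x (P.sem x) (S.mem u) = true

/-- Membership is decidable. [folklore] -/
instance : DecidablePred (S.Mem x) := fun u => by unfold Mem; infer_instance

/-- The current part on input `x`. [folklore] -/
def part : Finset V := univ.filter fun u => S.Mem x u

/-- Membership in the part. [folklore] -/
theorem mem_part {u : V} : u ∈ S.part x ↔ S.Mem x u := by simp [part]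

/-- **Interpretation data**: a simple graph on the part read by the `adj` wires and a colouring of
the part whose kernel is read by the `eq` wires. [folklore] -/
structure Reads (G : _root_.SimpleGraph (S.part x)) (col : S.part x → ℕ) : Prop where
  /-- adjacency wires read the graph -/
  adj_iff : ∀ a b : S.part x, wval x (P.sem x) (S.adj a b) = true ↔ G.Adj a b
  /-- kernel wires read the kernel of the colouring -/
  eq_iff : ∀ a b : S.part x, wval x (P.sem x) (S.eq a b) = true ↔ col a = col b

variable {S x} {G : _root_.SimpleGraph (S.part x)} {col : S.part x → ℕ}

/-- `pr u v a b` for member `u, v`. [folklore] -/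
theorem sem_pr (h : S.Reads x G col) (u v : S.part x) (a b : V) :
    P.sem x (S.pr u v a b) = true ↔ ∃ (ha : S.Mem x a) (hb : S.Mem x b),
      col ⟨a, (S.mem_part x).2 ha⟩ = col u ∧ col ⟨b, (S.mem_part x).2 hb⟩ = col v := by
  rw [P.sem_and (S.kind_pr u v a b), S.srcs_pr]
  simp only [mem_insert, mem_singleton, forall_eq_or_imp, forall_eq]
  constructor
  · rintro ⟨ha, hb, hau, hbv⟩
    exact ⟨ha, hb, (h.eq_iff ⟨a, _⟩ u).1 hau, (h.eq_iff ⟨b, _⟩ v).1 hbv⟩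
  · rintro ⟨ha, hb, hau, hbv⟩
    exact ⟨ha, hb, (h.eq_iff ⟨a, _⟩ u).2 hau, (h.eq_iff ⟨b, _⟩ v).2 hbv⟩

/-- `apr u v a b` for member `u, v`. [folklore] -/
theorem sem_apr (h : S.Reads x G col) (u v : S.part x) (a b : V) :
    P.sem x (S.apr u v a b) = true ↔ ∃ (ha : S.Mem x a) (hb : S.Mem x b),
      (col ⟨a, (S.mem_part x).2 ha⟩ = col u ∧ col ⟨b, (S.mem_part x).2 hb⟩ = col v) ∧
        G.Adj ⟨a, (S.mem_part x).2 ha⟩ ⟨b, (S.mem_part x).2 hb⟩ := by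
  rw [P.sem_and (S.kind_apr u v a b), S.srcs_apr]
  simp only [mem_insert, mem_singleton, forall_eq_or_imp, forall_eq, wval_inr, sem_pr h]
  constructor
  · rintro ⟨⟨ha, hb, hc⟩, hadj⟩
    exact ⟨ha, hb, hc, (h.adj_iff ⟨a, _⟩ ⟨b, _⟩).1 hadj⟩
  · rintro ⟨ha, hb, hc, hadj⟩
    exact ⟨⟨ha, hb, hc⟩, (h.adj_iff ⟨a, _⟩ ⟨b, _⟩).2 hadj⟩

/-- The true count of an injectively indexed image set of gates. [folklore] -/
theorem trueCount_image {α : Type*} [Fintype α] (f : α → Λ) (hf : Function.Injective f) :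
    P.trueCount x (univ.image fun a => Sum.inr (f a)) = (univ.filter fun a => P.sem x (f a) = true).card := by
  unfold trueCount
  rw [Finset.filter_image, Finset.card_image_of_injective]
  · rfl
  · intro a a' h'; exact hf (Sum.inr_injective h')

/-- **The first count is the number of pairs in the block**: `|cell u| · |cell v|`. [folklore] -/
theorem countA_eq (h : S.Reads x G col) (u v : S.part x) :
    (S.twice u v).a x = cellCard col (col u) * cellCard col (col v) := by
  show P.trueCount x (S.twice u v).A = _
  rw [S.twice_A, trueCount_image (P := P) (x := x) (fun ab : V × V => S.pr u v ab.1 ab.2) (S.pr_injective u v)]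
  unfold cellCard
  rw [← Finset.card_product]
  refine Finset.card_bij (fun ab hab => (⟨ab.1, (S.mem_part x).2 ((sem_pr h u v ab.1 ab.2).1 (mem_filter.1 hab).2).1⟩,
      ⟨ab.2, (S.mem_part x).2 ((sem_pr h u v ab.1 ab.2).1 (mem_filter.1 hab).2).2.1⟩)) ?_ ?_ ?_
  · intro ab hab
    obtain ⟨ha, hb, hau, hbv⟩ := (sem_pr h u v ab.1 ab.2).1 (mem_filter.1 hab).2
    simp only [mem_product, mem_filter, mem_univ, true_and]
    exact ⟨hau, hbv⟩
  · intro ab _ ab' _ hh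
    simp only [Prod.mk.injEq, Subtype.mk.injEq] at hh
    exact Prod.ext hh.1 hh.2
  · rintro ⟨⟨a, haU⟩, ⟨b, hbU⟩⟩ hab
    simp only [mem_product, mem_filter, mem_univ, true_and] at hab
    refine ⟨(a, b), mem_filter.2 ⟨mem_univ _, (sem_pr h u v a b).2
      ⟨(S.mem_part x).1 haU, (S.mem_part x).1 hbU, hab.1, hab.2⟩⟩, rfl⟩

variable [DecidableRel G.Adj]

/-- **The second count is the number of adjacent pairs in the block**: `e(cell u, cell v)`. [folklore] -/
theorem countB_eq (h : S.Reads x G col) (u v : S.part x) :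
    (S.twice u v).b x = crossEdges G col (col u) (col v) := by
  show P.trueCount x (S.twice u v).B = _
  rw [S.twice_B, trueCount_image (P := P) (x := x) (fun ab : V × V => S.apr u v ab.1 ab.2) (S.apr_injective u v)]
  unfold crossEdges
  refine Finset.card_bij (fun ab hab => (⟨ab.1, (S.mem_part x).2 ((sem_apr h u v ab.1 ab.2).1 (mem_filter.1 hab).2).1⟩,
      ⟨ab.2, (S.mem_part x).2 ((sem_apr h u v ab.1 ab.2).1 (mem_filter.1 hab).2).2.1⟩)) ?_ ?_ ?_
  · intro ab hab
    obtain ⟨ha, hb, ⟨hau, hbv⟩, hadj⟩ := (sem_apr h u v ab.1 ab.2).1 (mem_filter.1 hab).2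
    simp only [mem_filter, mem_univ, true_and]
    exact ⟨hau, hbv, hadj⟩
  · intro ab _ ab' _ hh
    simp only [Prod.mk.injEq, Subtype.mk.injEq] at hh
    exact Prod.ext hh.1 hh.2
  · rintro ⟨⟨a, haU⟩, ⟨b, hbU⟩⟩ hab
    simp only [mem_filter, mem_univ, true_and] at hab
    refine ⟨(a, b), mem_filter.2 ⟨mem_univ _, (sem_apr h u v a b).2
      ⟨(S.mem_part x).1 haU, (S.mem_part x).1 hbU, ⟨hab.1, hab.2.1⟩, hab.2.2⟩⟩, rfl⟩

/-- The cross-edge count is bounded by `|part|²`. [folklore] -/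
theorem crossEdges_le (c d : ℕ) : crossEdges G col c d ≤ (S.part x).card ^ 2 := by
  unfold crossEdges
  refine (Finset.card_filter_le _ _).trans ?_
  rw [Finset.card_univ, Fintype.card_prod, Fintype.card_coe, sq]

/-- **`tw u v` carries the switching test** `|cell u|·|cell v| < 2·e(cell u, cell v)`. [cite: Laubner2011, Def. 3.3.2] -/
theorem sem_tw_iff (h : S.Reads x G col) (hN : (S.part x).card ^ 2 ≤ N) (u v : S.part x) :
    P.sem x (S.twice u v).tw = true ↔ Switch G col (col u) (col v) := by
  rw [(S.twice u v).sem_tw x (by rw [countB_eq h]; exact (crossEdges_le _ _).trans hN), countA_eq h,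
    countB_eq h]
  rfl

/-- `sw' u v`: the XOR of adjacency and the switching test. [folklore] -/
theorem sem_sw' (h : S.Reads x G col) (hN : (S.part x).card ^ 2 ≤ N) (u v : S.part x) :
    P.sem x (S.sw' u v) = true ↔ (G.Adj u v ↔ ¬ Switch G col (col u) (col v)) := by
  rw [P.sem_or (S.kind_sw' u v), S.srcs_sw']
  simp only [mem_insert, mem_singleton, exists_eq_or_imp, exists_eq_left, wval_inr]
  rw [P.sem_and (S.kind_kept u v), S.srcs_kept, P.sem_and (S.kind_added u v), S.srcs_added]
  simp only [mem_insert, mem_singleton, forall_eq_or_imp, forall_eq, wval_inr]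
  rw [P.sem_nor_singleton (S.kind_ntw u v) (S.srcs_ntw u v), P.sem_nor_singleton (S.kind_nadj u v) (S.srcs_nadj u v),
    wval_inr, Bool.not_eq_true', Bool.not_eq_true', ← Bool.not_eq_true, ← Bool.not_eq_true,
    sem_tw_iff h hN, h.adj_iff]
  tauto

/-- **`sw u v` carries adjacency in the switching-equivalent graph of the part.** [cite: Laubner2011, Def. 3.3.2] -/
theorem sem_sw_iff (h : S.Reads x G col) (hN : (S.part x).card ^ 2 ≤ N) (u v : S.part x) :
    P.sem x (S.sw u v) = true ↔ (swGraph G col).Adj u v := by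
  by_cases huv : u = v
  · subst huv
    have hk : P.kind (S.sw u u) = Kind.or := by rw [S.kind_sw, if_pos rfl]
    rw [P.sem_or hk, S.srcs_sw, if_pos rfl]
    simp only [Finset.notMem_empty, false_and, exists_false, false_iff]
    exact fun hadj => hadj.1 rfl
  · have huv' : (u : V) ≠ v := fun h' => huv (Subtype.ext h')
    have hk : P.kind (S.sw u v) = Kind.and := by rw [S.kind_sw, if_neg huv']
    rw [P.sem_and hk, S.srcs_sw, if_neg huv']
    simp only [mem_insert, mem_singleton, forall_eq_or_imp, forall_eq, wval_inr, sem_sw' h hN]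
    change S.Mem x u ∧ S.Mem x v ∧ _ ↔ _
    simp only [(S.mem_part x).1 u.2, (S.mem_part x).1 v.2, true_and]
    exact ⟨fun h' => ⟨huv, h'⟩, fun h' => h'.2⟩

/-- Off the part `sw` is off. [folklore] -/
theorem sem_sw_of_not_mem {u : V} (hu : ¬ S.Mem x u) (v : V) : P.sem x (S.sw u v) = false := by
  by_cases huv : u = v
  · subst huv
    have hk : P.kind (S.sw u u) = Kind.or := by rw [S.kind_sw, if_pos rfl]
    rw [← Bool.not_eq_true, P.sem_or hk, S.srcs_sw, if_pos rfl]
    simp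
  · have hk : P.kind (S.sw u v) = Kind.and := by rw [S.kind_sw, if_neg huv]
    rw [← Bool.not_eq_true, P.sem_and hk, S.srcs_sw, if_neg huv]
    simp only [mem_insert, mem_singleton, forall_eq_or_imp, forall_eq, not_and]
    intro hm
    exact absurd hm hu

end Switching

end SymProg

end Literature.Computability.Complexity
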